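import Literature.Computability.MetaComplexity.GaussianWidthDepthFregeRows
import HarnessLib

/-!
# Local clause refutations give short bounded-depth `textbookFrege` refutations

Topic `Literature/Computability/MetaComplexity`. A **local refutation** of a CNF `φ` is a list of
clauses, each a SEMANTIC consequence of at most two clauses that are initial (in `φ`) or occur
earlier in the list, the three clauses together mentioning at most `N` variables, the list
containing the empty clause (`IsLocalRefutation φ N W cs`, with `W` a bound on all clause
lengths). Resolution refutations of width `w` are local refutations with `N = 3w` (resolvent and
premises), but no syntactic rule is imposed: any sound two-premise step over few variables is
allowed, which is the convenient currency for dynamic-programming refutations.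

* `IsLocalRefutation.bd` — a local refutation yields a bounded derivation (`TextbookFrege.BD`,
  disjunct depth `16`) of `¬ ofCNF φ` with an explicit line budget: start the accumulating chain of
  `DepthFregeLocalChain.lean` at the axiom `⊢ ⋀φ, ¬⋀φ` (`ofCNF φ = ⋀ (map clauseOf φ)`,
  `ofCNF_eq_conjList`), add the clauses of the list one by one (`chainLocalS`: two conjunct
  extractions, one truth table over the `≤ N` variables, cuts), and finish when `⊥ = clauseOf []`
  has been added (`chainFinalS`);
* `IsLocalRefutation.exists_isDepthProofOf` — hence a depth-`17` `textbookFrege` proof of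
  `¬ ofCNF φ` of size `≤ 2^(N+27) · (|φ| + |cs| + W + N + 2)^6`.

References: the simulated objects are folklore (width-`w` resolution inside depth-2 Frege,
Krajíček, *Proof complexity*, CUP 2019, §5.4 and Lemma 3.2.1); the toolkit is the tree's
(`FregeBounded.lean`, `DepthFregeLocalChain.lean`, after Galesi–Itsykson–Riazanov–Sofronova,
APAL 174 (2023), Lemma 4).
-/

namespace Literature.Computability.MetaComplexity

open Complexity Complexity.PropForm TextbookFrege
open KrajicekRamsey (litOf ofCNF_eq_conjList dd_clauseOf_le)

/-! ### Local refutations -/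

/-- One **local step**: the clause `C` follows semantically from two clauses `A₁, A₂`, each a
clause of `φ` or a member of `prev`, and the three clauses mention only variables of a
duplicate-free list `V` of length `≤ N`. [folklore] -/
def IsLocalStep (φ : CNF ℕ) (N : ℕ) (prev : List (Clause ℕ)) (C : Clause ℕ) : Prop :=
  ∃ (A₁ A₂ : Clause ℕ) (V : List ℕ), (A₁ ∈ φ ∨ A₁ ∈ prev) ∧ (A₂ ∈ φ ∨ A₂ ∈ prev) ∧ V.Nodup ∧
    V.length ≤ N ∧ (∀ l ∈ A₁, l.1 ∈ V) ∧ (∀ l ∈ A₂, l.1 ∈ V) ∧ (∀ l ∈ C, l.1 ∈ V) ∧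
    ∀ τ : ℕ → Bool, A₁.eval τ = true → A₂.eval τ = true → C.eval τ = true

/-- A local step stays a local step when more previous clauses are available. [folklore] -/
theorem IsLocalStep.mono {φ : CNF ℕ} {N : ℕ} {prev prev' : List (Clause ℕ)} {C : Clause ℕ}
    (h : IsLocalStep φ N prev C) (hsub : ∀ A ∈ prev, A ∈ prev') : IsLocalStep φ N prev' C := by
  obtain ⟨A₁, A₂, V, h1, h2, hV, hN, hv1, hv2, hvC, himp⟩ := h
  exact ⟨A₁, A₂, V, h1.imp_right (hsub _), h2.imp_right (hsub _), hV, hN, hv1, hv2, hvC, himp⟩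

/-- A **local refutation** of `φ` with locality `N` and width `W`: a list of clauses of length
`≤ W` (as are the clauses of `φ`), each a local step over the clauses of `φ` and the earlier
members, containing the empty clause. [folklore] -/
structure IsLocalRefutation (φ : CNF ℕ) (N W : ℕ) (cs : List (Clause ℕ)) : Prop where
  /-- every member is a local step over `φ` and the earlier members -/
  step : ∀ k (hk : k < cs.length), IsLocalStep φ N (cs.take k) (cs[k]'hk)
  /-- members are short -/
  width : ∀ C ∈ cs, C.length ≤ W
  /-- initial clauses are short -/
  width_init : ∀ C ∈ φ, C.length ≤ W
  /-- the empty clause is derived -/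
  nil_mem : [] ∈ cs

namespace IsLocalRefutation

variable {φ : CNF ℕ} {N W : ℕ} {cs : List (Clause ℕ)}

/-! ### The chain -/

/-- The size budget of a clause formula of a local refutation. [folklore] -/
theorem size_clauseOf_le_P {C : Clause ℕ} (hC : C.length ≤ W) :
    (KrajicekRamsey.clauseOf C).size ≤ 3 * W + 1 :=
  (OntoPHPReduction.size_clauseOf_le C).trans (by omega)

/-- The members of the carried conjunction after `k` steps: the first `k` derived clauses (most
recent first) followed by the clauses of `φ`, as formulas. [folklore] -/
def carried (φ : CNF ℕ) (cs : List (Clause ℕ)) (k : ℕ) : List (PropForm ℕ) :=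
  ((cs.take k).reverse.map KrajicekRamsey.clauseOf) ++ φ.map KrajicekRamsey.clauseOf

/-- Every carried member is the formula of a clause of `φ` or of `cs`. [folklore] -/
theorem mem_carried {k : ℕ} {X : PropForm ℕ} (hX : X ∈ carried φ cs k) :
    ∃ C, (C ∈ φ ∨ C ∈ cs.take k) ∧ X = KrajicekRamsey.clauseOf C := by
  unfold carried at hX
  rcases List.mem_append.1 hX with hX | hX
  · obtain ⟨C, hC, rfl⟩ := List.mem_map.1 hX
    exact ⟨C, Or.inr (List.mem_reverse.1 hC), rfl⟩
  · obtain ⟨C, hC, rfl⟩ := List.mem_map.1 hX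
    exact ⟨C, Or.inl hC, rfl⟩

/-- A clause of `φ` or an earlier member is carried. [folklore] -/
theorem clauseOf_mem_carried {k : ℕ} {C : Clause ℕ} (hC : C ∈ φ ∨ C ∈ cs.take k) :
    KrajicekRamsey.clauseOf C ∈ carried φ cs k := by
  unfold carried
  rcases hC with hC | hC
  · exact List.mem_append_right _ (List.mem_map.2 ⟨C, hC, rfl⟩)
  · exact List.mem_append_left _ (List.mem_map.2 ⟨C, List.mem_reverse.2 hC, rfl⟩)

/-- The length of the carried list. [folklore] -/
theorem length_carried_le (k : ℕ) : (carried φ cs k).length ≤ φ.length + cs.length := by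
  unfold carried
  simp only [List.length_append, List.length_map, List.length_reverse, List.length_take]
  omega

/-- One more step prepends the new clause formula. [folklore] -/
theorem carried_succ {k : ℕ} (hk : k < cs.length) :
    carried φ cs (k + 1) = KrajicekRamsey.clauseOf (cs[k]'hk) :: carried φ cs k := by
  unfold carried
  rw [List.take_succ_eq_append_getElem hk, List.reverse_append, List.reverse_singleton,
    List.singleton_append, List.map_cons, List.cons_append]

/-- **The chain invariant.** After `k ≤ |cs|` steps: `⊢ ⋀(carried k), ¬⋀φ` with
`462 + k · stepLines P Q N` lines (`P = 3W + 1`, `Q = |φ| + |cs| + 1`). [folklore] -/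
theorem chain (h : IsLocalRefutation φ N W cs) {B : ℕ}
    (hB : 128 * ((φ.length + cs.length + 1) * (3 * W + 1 + 1) + 1) + 40 * N + 600 ≤ B) :
    ∀ k, k ≤ cs.length →
      BD 16 B (462 + k * stepLines (3 * W + 1) (φ.length + cs.length + 1) N)
        (disjList [conjList (carried φ cs k), neg (conjList (φ.map KrajicekRamsey.clauseOf))]) := by
  -- the common budgets
  set P := 3 * W + 1 with hP
  set Q := φ.length + cs.length + 1 with hQ
  set M₀ := φ.map KrajicekRamsey.clauseOf with hM₀
  have hddM : ∀ k, ∀ X ∈ carried φ cs k, X.dd ≤ 3 := fun k X hX => by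
    obtain ⟨C, -, rfl⟩ := mem_carried hX
    exact (dd_clauseOf_le C).trans (by norm_num)
  have hPM : ∀ k, ∀ X ∈ carried φ cs k, X.size ≤ P := fun k X hX => by
    obtain ⟨C, hC, rfl⟩ := mem_carried hX
    rcases hC with hC | hC
    · exact size_clauseOf_le_P (h.width_init C hC)
    · exact size_clauseOf_le_P (h.width C (List.mem_of_mem_take hC))
  have hM₀size : (conjList M₀).size ≤ Q * (P + 1) + 1 := by
    have e : carried φ cs 0 = M₀ := by simp [carried, hM₀]
    have h1 := size_conjList_le (M := M₀) (P := P) (Q := Q) (fun X hX => hPM 0 X (e ▸ hX))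
      (by rw [hM₀, List.length_map]; omega)
    exact h1
  have hM₀dd : (conjList M₀).dd ≤ 5 := by
    have e : carried φ cs 0 = M₀ := by simp [carried, hM₀]
    exact dd_conjList_le_five fun X hX => hddM 0 X (e ▸ hX)
  have hΦdd : (neg (conjList M₀)).dd ≤ 6 := by
    have e : carried φ cs 0 = M₀ := by simp [carried, hM₀]
    exact dd_neg_conjList_le_six fun X hX => hddM 0 X (e ▸ hX)
  have hΦB : 8 * (neg (conjList M₀)).size ≤ B := by
    simp only [size]
    have : 8 * (Q * (P + 1) + 1 + 1) ≤ B := by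
      have hQ1 : 1 ≤ Q := by omega
      nlinarith
    omega
  intro k
  induction k with
  | zero =>
    intro _
    -- the axiom `⊢ ¬⋀φ, ⋀φ`, reordered
    have ax : BD 16 B 12 (disjList [neg (conjList M₀), conjList M₀]) :=
      axS (conjList M₀) (by omega) (by nlinarith)
    have e : carried φ cs 0 = M₀ := by simp [carried, hM₀]
    rw [e, Nat.zero_mul, Nat.add_zero]
    have hsub : ∀ X ∈ [neg (conjList M₀), conjList M₀], X ∈ [conjList M₀, neg (conjList M₀)] := by
      intro X hX
      simp only [List.mem_cons, List.not_mem_nil, or_false] at hX ⊢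
      tauto
    refine (subsetN (N := 2) ax hsub (p := 6) ?_ (by norm_num) ?_ (by simp) (by simp)).mono (by norm_num)
    · intro X hX
      simp only [List.mem_cons, List.not_mem_nil, or_false] at hX
      rcases hX with rfl | rfl
      · exact hM₀dd.trans (by norm_num)
      · exact hΦdd
    · simp only [size_disjList_cons, size_disjList_nil, size]
      nlinarith
  | succ k ih =>
    intro hk
    have hk' : k < cs.length := Nat.lt_of_succ_le hk
    have J := ih hk'.le
    obtain ⟨A₁, A₂, V, h1, h2, hV, hVN, hv1, hv2, hvC, himp⟩ := h.step k hk'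
    rw [carried_succ hk']
    have hC : (KrajicekRamsey.clauseOf (cs[k]'hk')).dd ≤ 3 := (dd_clauseOf_le _).trans (by norm_num)
    have hCP : (KrajicekRamsey.clauseOf (cs[k]'hk')).size ≤ P :=
      size_clauseOf_le_P (h.width _ (List.getElem_mem hk'))
    have step := chainLocalS (D := 16) (M := carried φ cs k) (A₁ := KrajicekRamsey.clauseOf A₁) (A₂ := KrajicekRamsey.clauseOf A₂)
      (C := KrajicekRamsey.clauseOf (cs[k]'hk')) (Φ := neg (conjList M₀)) (P := P) (Q := Q) (N := N) V hV hVN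
      (hddM k) (hPM k) (by have := length_carried_le (φ := φ) (cs := cs) k; omega)
      (clauseOf_mem_carried h1) (clauseOf_mem_carried h2) hC hCP
      (fun x hx => by obtain ⟨l, hl, rfl⟩ := OntoPHPReduction.exists_of_mem_vars_clauseOf hx; exact hvC l hl)
      (fun x hx => by obtain ⟨l, hl, rfl⟩ := OntoPHPReduction.exists_of_mem_vars_clauseOf hx; exact hv1 l hl)
      (fun x hx => by obtain ⟨l, hl, rfl⟩ := OntoPHPReduction.exists_of_mem_vars_clauseOf hx; exact hv2 l hl)
      (fun τ hτ1 hτ2 => by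
        rw [TextbookFrege.eval_clauseOf'] at hτ1 hτ2 ⊢
        exact himp τ hτ1 hτ2)
      hΦdd hΦB J (by norm_num) hB
    refine step.mono ?_
    rw [Nat.succ_mul]
    omega

/-- **A local refutation yields a bounded derivation of `¬ ofCNF φ`** with an explicit line
budget. [folklore] -/
theorem bd (h : IsLocalRefutation φ N W cs) {B : ℕ}
    (hB : 128 * ((φ.length + cs.length + 1) * (3 * W + 1 + 1) + 1) + 40 * N + 600 ≤ B) :
    BD 16 B (462 + cs.length * stepLines (3 * W + 1) (φ.length + cs.length + 1) N +
        126 * (φ.length + cs.length + 1) + 3000) (neg (ofCNF φ)) := by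
  have J := h.chain hB cs.length le_rfl
  have hbot : const false ∈ carried φ cs cs.length := by
    have : KrajicekRamsey.clauseOf ([] : Clause ℕ) = const false := rfl
    rw [← this]
    exact clauseOf_mem_carried (Or.inr (by rw [List.take_length]; exact h.nil_mem))
  have hddM : ∀ X ∈ carried φ cs cs.length, X.dd ≤ 3 := fun X hX => by
    obtain ⟨C, -, rfl⟩ := mem_carried hX
    exact (dd_clauseOf_le C).trans (by norm_num)
  have hPM : ∀ X ∈ carried φ cs cs.length, X.size ≤ 3 * W + 1 := fun X hX => by
    obtain ⟨C, hC, rfl⟩ := mem_carried hX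
    rcases hC with hC | hC
    · exact size_clauseOf_le_P (h.width_init C hC)
    · exact size_clauseOf_le_P (h.width C (List.mem_of_mem_take hC))
  have hΦdd : (neg (conjList (φ.map KrajicekRamsey.clauseOf))).dd ≤ 6 := by
    have e : carried φ cs 0 = φ.map KrajicekRamsey.clauseOf := by simp [carried]
    exact dd_neg_conjList_le_six fun X hX => by
      rw [← e] at hX
      obtain ⟨C, -, rfl⟩ := mem_carried hX
      exact (dd_clauseOf_le C).trans (by norm_num)
  have hM₀size : (conjList (φ.map KrajicekRamsey.clauseOf)).size ≤
      (φ.length + cs.length + 1) * (3 * W + 1 + 1) + 1 := by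
    have e : carried φ cs 0 = φ.map KrajicekRamsey.clauseOf := by simp [carried]
    exact size_conjList_le (M := φ.map KrajicekRamsey.clauseOf) (P := 3 * W + 1) (Q := φ.length + cs.length + 1)
      (fun X hX => by
        rw [← e] at hX
        obtain ⟨C, hC, rfl⟩ := mem_carried hX
        rcases hC with hC | hC
        · exact size_clauseOf_le_P (h.width_init C hC)
        · simp at hC)
      (by rw [List.length_map]; omega)
  have hΦB : 8 * (neg (conjList (φ.map KrajicekRamsey.clauseOf))).size ≤ B := by
    simp only [size]
    have hQ1 : 1 ≤ φ.length + cs.length + 1 := by omega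
    nlinarith
  have fin := chainFinalS (D := 16) (P := 3 * W + 1) (Q := φ.length + cs.length + 1) hddM hPM
    (length_carried_le cs.length |>.trans (by omega)) hbot hΦdd hΦB J (by norm_num) (by omega)
  rw [ofCNF_eq_conjList]
  exact fin.mono le_rfl

/-! ### Numerics and the proof -/

/-- The bracket of `stepLines` is cubic. [folklore] -/
theorem bracket_le (W N X : ℕ) (hW : W + 2 ≤ X) (hN : N + 2 ≤ X) :
    (3 * (3 * W + 1) + 5) * (100 * (N + 8) ^ 2) + 50 * (N + 6) ^ 2 + 2 ≤ 2 ^ 15 * X ^ 3 := by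
  have h1 : 3 * (3 * W + 1) + 5 ≤ 12 * X := by omega
  have h2 : (N + 8) ^ 2 ≤ 16 * X ^ 2 := by nlinarith
  have h3 : (N + 6) ^ 2 ≤ 16 * X ^ 2 := by nlinarith
  have h4 : (3 * (3 * W + 1) + 5) * (100 * (N + 8) ^ 2) ≤ (12 * X) * (100 * (16 * X ^ 2)) :=
    Nat.mul_le_mul h1 (Nat.mul_le_mul_left _ h2)
  have hX : 1 ≤ X := by omega
  have hX3 : 1 ≤ X ^ 3 := Nat.one_le_pow _ _ hX
  have e : (12 * X) * (100 * (16 * X ^ 2)) = 19200 * X ^ 3 := by ring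
  have h5 : 50 * (N + 6) ^ 2 ≤ 800 * X ^ 3 := by nlinarith
  rw [e] at h4
  omega

/-- The step cost is cubic times `2^N`. [folklore] -/
theorem stepLines_le (L C W N : ℕ) :
    stepLines (3 * W + 1) (L + C + 1) N ≤ 2 ^ N * (2 ^ 16 * (L + C + W + N + 2) ^ 3) := by
  set X := L + C + W + N + 2 with hX
  have hX2 : 2 ≤ X := by omega
  have hXX : X ≤ X ^ 3 := by
    calc X = X ^ 1 := (pow_one X).symm
      _ ≤ X ^ 3 := Nat.pow_le_pow_right (by omega) (by norm_num)
  have hX3 : 8 ≤ X ^ 3 := by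
    calc 8 = 2 ^ 3 := by norm_num
      _ ≤ X ^ 3 := Nat.pow_le_pow_left hX2 3
  set T := 2 ^ N with hT
  have hT1 : 1 ≤ T := Nat.one_le_two_pow
  have hbr := bracket_le W N X (by omega) (by omega)
  set R := (3 * (3 * W + 1) + 5) * (100 * (N + 8) ^ 2) + 50 * (N + 6) ^ 2 + 2 with hR
  have e : stepLines (3 * W + 1) (L + C + 1) N = T * R + 252 * (L + C + 1) + 8000 := rfl
  have h1 : T * R ≤ T * (2 ^ 15 * X ^ 3) := Nat.mul_le_mul_left _ hbr
  have hLC : L + C + 1 ≤ X := by omega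
  have h2 : 252 * (L + C + 1) + 8000 ≤ 2 ^ 15 * X ^ 3 := by
    have : 252 * (L + C + 1) ≤ 252 * X ^ 3 := (Nat.mul_le_mul_left _ hLC).trans (Nat.mul_le_mul_left _ hXX)
    omega
  have h3 : 2 ^ 15 * X ^ 3 ≤ T * (2 ^ 15 * X ^ 3) := by
    calc 2 ^ 15 * X ^ 3 = 1 * (2 ^ 15 * X ^ 3) := (Nat.one_mul _).symm
      _ ≤ T * (2 ^ 15 * X ^ 3) := Nat.mul_le_mul_right _ hT1
  have e2 : T * (2 ^ 16 * X ^ 3) = T * (2 ^ 15 * X ^ 3) + T * (2 ^ 15 * X ^ 3) := by ring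
  calc stepLines (3 * W + 1) (L + C + 1) N = T * R + (252 * (L + C + 1) + 8000) := by rw [e]; ring
    _ ≤ T * (2 ^ 15 * X ^ 3) + T * (2 ^ 15 * X ^ 3) := Nat.add_le_add h1 (h2.trans h3)
    _ = T * (2 ^ 16 * X ^ 3) := e2.symm

/-- Polynomial bound on the line budget of `bd`. [folklore] -/
theorem lines_le (L C W N : ℕ) :
    462 + C * stepLines (3 * W + 1) (L + C + 1) N + 126 * (L + C + 1) + 3000 ≤
      2 ^ (N + 17) * (L + C + W + N + 2) ^ 4 := by
  set X := L + C + W + N + 2 with hX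
  have hX2 : 2 ≤ X := by omega
  have hX3 : 8 ≤ X ^ 3 := by
    calc 8 = 2 ^ 3 := by norm_num
      _ ≤ X ^ 3 := Nat.pow_le_pow_left hX2 3
  have hXX : X ≤ X ^ 3 := by
    calc X = X ^ 1 := (pow_one X).symm
      _ ≤ X ^ 3 := Nat.pow_le_pow_right (by omega) (by norm_num)
  set T := 2 ^ N with hT
  have hT1 : 1 ≤ T := Nat.one_le_two_pow
  set Y := T * (2 ^ 16 * X ^ 3) with hY
  have hstep : stepLines (3 * W + 1) (L + C + 1) N ≤ Y := stepLines_le L C W N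
  have hC : C ≤ X := by omega
  have h4 : C * stepLines (3 * W + 1) (L + C + 1) N ≤ X * Y := Nat.mul_le_mul hC hstep
  have hLC : L + C + 1 ≤ X := by omega
  have h5 : 462 + 126 * (L + C + 1) + 3000 ≤ X * Y := by
    have h6 : 462 + 126 * (L + C + 1) + 3000 ≤ 2 ^ 16 * X ^ 3 := by
      have : 126 * (L + C + 1) ≤ 126 * X ^ 3 :=
        (Nat.mul_le_mul_left _ hLC).trans (Nat.mul_le_mul_left _ hXX)
      omega
    calc 462 + 126 * (L + C + 1) + 3000 ≤ 2 ^ 16 * X ^ 3 := h6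
      _ = 1 * (1 * (2 ^ 16 * X ^ 3)) := by ring
      _ ≤ X * (T * (2 ^ 16 * X ^ 3)) := Nat.mul_le_mul (by omega) (Nat.mul_le_mul_right _ hT1)
  have e3 : 2 ^ (N + 17) * X ^ 4 = X * Y + X * Y := by
    rw [hY, hT, Nat.pow_add]; ring
  calc 462 + C * stepLines (3 * W + 1) (L + C + 1) N + 126 * (L + C + 1) + 3000
      = C * stepLines (3 * W + 1) (L + C + 1) N + (462 + 126 * (L + C + 1) + 3000) := by ring
    _ ≤ X * Y + X * Y := Nat.add_le_add h4 h5
    _ = 2 ^ (N + 17) * X ^ 4 := e3.symm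

/-- Polynomial bound on the line-size budget. [folklore] -/
theorem budget_le (L C W N : ℕ) :
    128 * ((L + C + 1) * (3 * W + 1 + 1) + 1) + 40 * N + 600 ≤ 2 ^ 10 * (L + C + W + N + 2) ^ 2 := by
  set X := L + C + W + N + 2 with hX
  have hX2 : 2 ≤ X := by omega
  have h1 : (L + C + 1) * (3 * W + 1 + 1) ≤ X * (3 * X) := Nat.mul_le_mul (by omega) (by omega)
  nlinarith

/-- **Local refutations give short bounded-depth proofs.** A local refutation of `φ` with
locality `N`, width `W` and `|cs|` clauses yields a depth-`17` `textbookFrege` proof of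
`¬ ofCNF φ` of size at most `2^(N+27) · (|φ| + |cs| + W + N + 2)^6`. [folklore] -/
theorem exists_isDepthProofOf (h : IsLocalRefutation φ N W cs) :
    ∃ π, textbookFrege.IsDepthProofOf 17 π (neg (ofCNF φ)) ∧
      proofSize π ≤ 2 ^ (N + 27) * (φ.length + cs.length + W + N + 2) ^ 6 := by
  set Bud := 128 * ((φ.length + cs.length + 1) * (3 * W + 1 + 1) + 1) + 40 * N + 600 with hBud
  have hbd := h.bd (B := Bud) le_rfl
  obtain ⟨π, hπ, hsize⟩ := hbd.exists_isDepthProofOf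
  refine ⟨π, hπ, hsize.trans ?_⟩
  have h1 := lines_le φ.length cs.length W N
  have h2 := budget_le φ.length cs.length W N
  calc (462 + cs.length * stepLines (3 * W + 1) (φ.length + cs.length + 1) N +
          126 * (φ.length + cs.length + 1) + 3000) * Bud
      ≤ (2 ^ (N + 17) * (φ.length + cs.length + W + N + 2) ^ 4) *
          (2 ^ 10 * (φ.length + cs.length + W + N + 2) ^ 2) := Nat.mul_le_mul h1 h2
    _ = 2 ^ (N + 27) * (φ.length + cs.length + W + N + 2) ^ 6 := by
        rw [show N + 27 = (N + 17) + 10 by omega, Nat.pow_add]; ring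

end IsLocalRefutation

/-! ### Staged local refutations

A convenient way to BUILD local refutations: a list of STAGES, every clause of a stage being a
local step over the clauses of `φ` and of the earlier stages (not of its own stage). Flattening
the stages gives the positional condition of `IsLocalRefutation.step`. -/

/-- **Staged local steps** over an initial stock `pre` of available clauses: every clause of the
first stage is a local step over `pre`, every clause of the second stage a local step over `pre`
and the first stage, and so on. [folklore] -/
def IsStaged (φ : CNF ℕ) (N : ℕ) : List (Clause ℕ) → List (List (Clause ℕ)) → Prop
  | _, [] => True
  | pre, S :: rest => (∀ C ∈ S, IsLocalStep φ N pre C) ∧ IsStaged φ N (pre ++ S) rest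

namespace IsStaged

variable {φ : CNF ℕ} {N : ℕ}

/-- Unfolding `IsStaged` on a nonempty list of stages. [folklore] -/
theorem cons_iff {pre : List (Clause ℕ)} {S : List (Clause ℕ)} {rest : List (List (Clause ℕ))} :
    IsStaged φ N pre (S :: rest) ↔ (∀ C ∈ S, IsLocalStep φ N pre C) ∧ IsStaged φ N (pre ++ S) rest :=
  Iff.rfl

/-- `IsStaged` on a concatenation of stage lists. [folklore] -/
theorem append_iff {pre : List (Clause ℕ)} {A B : List (List (Clause ℕ))} :
    IsStaged φ N pre (A ++ B) ↔ IsStaged φ N pre A ∧ IsStaged φ N (pre ++ A.flatten) B := by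
  induction A generalizing pre with
  | nil => simp [IsStaged]
  | cons S A ih =>
    rw [List.cons_append, cons_iff, cons_iff, ih, List.flatten_cons, List.append_assoc]
    tauto

/-- More available clauses keep stages staged. [folklore] -/
theorem mono {pre pre' : List (Clause ℕ)} {A : List (List (Clause ℕ))} (h : IsStaged φ N pre A)
    (hsub : ∀ C ∈ pre, C ∈ pre') : IsStaged φ N pre' A := by
  induction A generalizing pre pre' with
  | nil => trivial
  | cons S A ih =>
    refine ⟨fun C hC => (h.1 C hC).mono hsub, ih h.2 fun C hC => ?_⟩
    rcases List.mem_append.1 hC with hC | hC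
    · exact List.mem_append_left _ (hsub C hC)
    · exact List.mem_append_right _ hC

/-- A single stage. [folklore] -/
theorem single {pre : List (Clause ℕ)} {S : List (Clause ℕ)}
    (h : ∀ C ∈ S, IsLocalStep φ N pre C) : IsStaged φ N pre [S] :=
  ⟨h, trivial⟩

/-- **Flattening staged steps gives positional local steps**: every clause of the flattened
stages is a local step over `pre` and the clauses before it. [folklore] -/
theorem step_flatten {pre : List (Clause ℕ)} {A : List (List (Clause ℕ))} (h : IsStaged φ N pre A) :
    ∀ k (hk : k < A.flatten.length), IsLocalStep φ N (pre ++ A.flatten.take k) (A.flatten[k]'hk) := by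
  induction A generalizing pre with
  | nil => intro k hk; simp at hk
  | cons S A ih =>
    intro k hk
    obtain ⟨hS, hrest⟩ := h
    by_cases hkS : k < S.length
    · have e : (S :: A).flatten[k]'hk = S[k]'hkS := by
        simp only [List.flatten_cons]
        exact List.getElem_append_left hkS
      rw [e]
      exact (hS _ (List.getElem_mem hkS)).mono fun C hC => List.mem_append_left _ hC
    · push Not at hkS
      obtain ⟨j, rfl⟩ : ∃ j, k = S.length + j := ⟨k - S.length, by omega⟩
      have hj : j < A.flatten.length := by
        simp only [List.flatten_cons, List.length_append] at hk; omega
      have e : (S :: A).flatten[S.length + j]'hk = A.flatten[j]'hj := by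
        simp only [List.flatten_cons]
        rw [List.getElem_append_right (by omega)]
        simp
      have e2 : (S :: A).flatten.take (S.length + j) = S ++ A.flatten.take j := by
        simp only [List.flatten_cons]
        exact List.take_length_add_append j
      rw [e, e2, ← List.append_assoc]
      exact ih hrest j hj

end IsStaged

/-- **A staged refutation is a local refutation**: stages over the empty stock whose flattening
contains the empty clause, with all clauses short. [folklore] -/
theorem IsLocalRefutation.of_isStaged {φ : CNF ℕ} {N W : ℕ} {A : List (List (Clause ℕ))}
    (h : IsStaged φ N [] A) (hW : ∀ C ∈ A.flatten, C.length ≤ W) (hWφ : ∀ C ∈ φ, C.length ≤ W)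
    (hnil : [] ∈ A.flatten) : IsLocalRefutation φ N W A.flatten :=
  ⟨fun k hk => by simpa using h.step_flatten k hk, hW, hWφ, hnil⟩

end Literature.Computability.MetaComplexity
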